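import Summits.QuantumFields.YangMills.Theorems.ParabolicTrajectoryContinuumLimitOnTrajectoryUclObs
import Summits.QuantumFields.YangMills.Theorems.ParabolicTrajectoryContinuumLimitOnTrajectoryUclGap
import Literature.MathematicalPhysics.QuantumFieldTheory.SpeciesTimeReflection
import Literature.MathematicalPhysics.QuantumFieldTheory.SpeciesLatticeProducts

/-!
# Crux `ContinuumLimitOnTrajectory` (stmt-QuantumFields-10522), line `two-orbit-synchronisation` (seat c2):
# time windows, slabs, and the covariance-to-OS-pairing identity

Helper file (`--supports stmt-QuantumFields-10522`) for the registered stub `stub_uclOfGap : UCLOfGap` (skeleton v3.1).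
Bookkeeping that turns a covariance of two TIME-WINDOWED lattice observables into the reflected, translated OS pairing
that crux (B)'s `TorusOSGap` controls (`…UclGap`):

* `timeShiftInt Sd c` — torus time translation by an INTEGER `c` (`(τ_c U)(x,i) = U(x + c e₀, i)`; `torusTimeShift` is the
  case `c : ℕ`), its composition law and the invariance of Wilson's measure;
* `ReadsTimes X lo hi` — `X` depends only on links based at lattice times `t ∈ [lo, hi]` (read modulo the side, no `val`
  arithmetic); transport under `τ_c` (`[lo + c, hi + c]`) and under the site reflection `Θ'` (`[−hi − 1, −lo]`), and the
  comparison with the slab class `SlabGood` of `…UclGap` when `1 ≤ lo`, `hi ≤ w < Sd`;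
* `readsTimes_obsOf` — the observable of a test function whose points all have physical times in `[lo, hi]` reads only the
  lattice times `[⌈lo/a⌉ − R₀, ⌊hi/a⌋ + R₀]`, `R₀ = timeRadius r.curvature`;
* `cov_eq_osCorr` — for bounded measurable `A, B`, an integer shift `c` and `m' : ℕ`:
  `∫AB − ∫A∫B = osCorr μ_k Θ' τ_{m'} Y Z` with `Y = conj ∘ A ∘ τ_c ∘ Θ'`, `Z = B ∘ τ_c ∘ τ_{−m'}` (measure invariance only),
  and the slab localisation of `Y`, `Z` when `A` reads `[α₁, α₂]`, `B` reads `[β₁, β₂]`, `c = −α₂ − 2`, `m' = β₁ − α₂ − 3`.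

Vocabulary-free beyond `…UclObs`/`…UclGap`; nothing about Wilson's theory is asserted. Refs: Osterwalder–Seiler 1978 §2.
-/

set_option autoImplicit false

open scoped SchwartzMap ComplexConjugate
open MeasureTheory Filter Topology
open Literature.MathematicalPhysics.QuantumFieldTheory Literature.MathematicalPhysics.QuantumLattice
open Literature.MathematicalPhysics.AQFT Literature.Probability.LatticeModels

noncomputable section

namespace Summit.QuantumFields.YangMills.Cruxes.ContinuumLimitOnTrajectory.TwoOrbitSynchronisation

local notation "𝔼" => EuclideanSpace ℝ (Fin 4)

variable {G : Type} [Group G] [TopologicalSpace G] [IsTopologicalGroup G] [CompactSpace G]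
  [MeasurableSpace G] [BorelSpace G]

/-! ## Integer time shifts of the torus -/

/-- **Torus time translation by an integer** `c`: `(τ_c U)(x, i) = U(x + c e₀, i)` (`torusTimeShift Sd m` is `τ_m` for `m : ℕ`). -/
def timeShiftInt (Sd : ℕ) (c : ℤ) : GaugeConfig 4 Sd G ≃ᵐ GaugeConfig 4 Sd G :=
  torusConfigShift (Torus.proj Sd (-(Pi.single 0 c)))

omit [Group G] [TopologicalSpace G] [IsTopologicalGroup G] [CompactSpace G] [BorelSpace G] in
/-- Pointwise formula. -/
theorem timeShiftInt_apply (Sd : ℕ) (c : ℤ) (U : GaugeConfig 4 Sd G) (e : Edge 4 Sd) :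
    timeShiftInt Sd c U e = U (e.1 + Torus.proj Sd (Pi.single 0 c), e.2) := by
  have h : e.1 - Torus.proj Sd (-(Pi.single 0 c : Site 4)) = e.1 + Torus.proj Sd (Pi.single 0 c) := by
    funext i; simp [Torus.proj_apply, sub_neg_eq_add]
  simp only [timeShiftInt, torusConfigShift_apply, h]

omit [Group G] [TopologicalSpace G] [IsTopologicalGroup G] [CompactSpace G] [BorelSpace G] in
/-- `torusTimeShift` is the natural-number case. -/
theorem torusTimeShift_eq_timeShiftInt (Sd m : ℕ) : (torusTimeShift Sd m : GaugeConfig 4 Sd G ≃ᵐ GaugeConfig 4 Sd G) =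
    timeShiftInt Sd (m : ℤ) := rfl

omit [Group G] [TopologicalSpace G] [IsTopologicalGroup G] [CompactSpace G] [BorelSpace G] in
/-- Composition law `τ_c (τ_d U) = τ_{c+d} U`. -/
theorem timeShiftInt_timeShiftInt (Sd : ℕ) (c d : ℤ) (U : GaugeConfig 4 Sd G) :
    timeShiftInt Sd c (timeShiftInt Sd d U) = timeShiftInt Sd (c + d) U := by
  funext e
  have h : Torus.proj Sd (Pi.single 0 c : Site 4) + Torus.proj Sd (Pi.single 0 d) =
      Torus.proj Sd (Pi.single 0 (c + d)) := by
    funext i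
    by_cases hi : i = 0
    · subst hi; simp [Torus.proj_apply]
    · simp [Torus.proj_apply, hi]
  simp only [timeShiftInt_apply, add_assoc, h]

omit [Group G] [TopologicalSpace G] [IsTopologicalGroup G] [CompactSpace G] [BorelSpace G] in
/-- `τ_0 = id`. -/
theorem timeShiftInt_zero (Sd : ℕ) (U : GaugeConfig 4 Sd G) : timeShiftInt Sd 0 U = U := by
  funext e
  have h : Torus.proj Sd (0 : Site 4) = 0 := by funext i; simp [Torus.proj_apply]
  simp [timeShiftInt_apply, h]

/-- **Wilson's torus measure is invariant under integer time shifts.** -/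
theorem integral_comp_timeShiftInt {N : ℕ} (ρ : G →* Matrix (Fin N) (Fin N) ℂ) (β : ℝ) (Sd : ℕ) [NeZero Sd] (c : ℤ)
    {E : Type*} [NormedAddCommGroup E] [NormedSpace ℝ E] (f : GaugeConfig 4 Sd G → E) :
    ∫ U, f (timeShiftInt Sd c U) ∂(wilsonMeasure (d := 4) (L := Sd) ρ β) = ∫ U, f U ∂(wilsonMeasure (d := 4) (L := Sd) ρ β) :=
  wilsonExpectation_comp_torusConfigShift ρ β _ f

/-! ## Reading windows of lattice times -/

/-- **`X` reads only the lattice times `[lo, hi]`**: `X` depends only on the links whose base point has time coordinate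
`t mod Sd` for some integer `t ∈ [lo, hi]`. -/
def ReadsTimes {Sd : ℕ} {α : Type*} (X : GaugeConfig 4 Sd G → α) (lo hi : ℤ) : Prop :=
  DependsOn X {e : Edge 4 Sd | ∃ t : ℤ, lo ≤ t ∧ t ≤ hi ∧ e.1 0 = (t : ZMod Sd)}

omit [Group G] [TopologicalSpace G] [IsTopologicalGroup G] [CompactSpace G] [MeasurableSpace G] [BorelSpace G] in
/-- Enlarging the window. -/
theorem ReadsTimes.mono {Sd : ℕ} {α : Type*} {X : GaugeConfig 4 Sd G → α} {lo hi lo' hi' : ℤ} (h : ReadsTimes X lo hi)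
    (hlo : lo' ≤ lo) (hhi : hi ≤ hi') : ReadsTimes X lo' hi' := by
  refine DependsOn.mono (fun e he => ?_) h
  obtain ⟨t, h1, h2, h3⟩ := he
  exact ⟨t, hlo.trans h1, h2.trans hhi, h3⟩

omit [Group G] [TopologicalSpace G] [IsTopologicalGroup G] [CompactSpace G] [BorelSpace G] in
/-- **Transport under time shifts**: `X ∘ τ_c` reads `[lo + c, hi + c]`. -/
theorem ReadsTimes.comp_timeShiftInt {Sd : ℕ} {α : Type*} {X : GaugeConfig 4 Sd G → α} {lo hi : ℤ} (h : ReadsTimes X lo hi)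
    (c : ℤ) : ReadsTimes (fun U => X (timeShiftInt Sd c U)) (lo + c) (hi + c) := by
  intro U V hUV
  refine h fun e he => ?_
  obtain ⟨t, h1, h2, h3⟩ := he
  simp only [timeShiftInt_apply]
  refine hUV _ ⟨t + c, by omega, by omega, ?_⟩
  simp only [Pi.add_apply, Torus.proj_apply, Pi.single_eq_same, h3, Int.cast_add]

omit [TopologicalSpace G] [IsTopologicalGroup G] [CompactSpace G] [MeasurableSpace G] [BorelSpace G] in
/-- **Transport under the site reflection**: `X ∘ Θ'` reads `[−hi − 1, −lo]` (spatial links at time `t` come from time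
`−t`, the reversed temporal link based at `t` from the one based at `−t − 1`). -/
theorem ReadsTimes.comp_negReflect {Sd : ℕ} {α : Type*} {X : GaugeConfig 4 Sd G → α} {lo hi : ℤ} (h : ReadsTimes X lo hi) :
    ReadsTimes (fun U : GaugeConfig 4 Sd G => X U.negReflect) (-hi - 1) (-lo) := by
  intro U V hUV
  refine h fun e he => ?_
  obtain ⟨x, i⟩ := e
  obtain ⟨t, h1, h2, h3⟩ := he
  simp only at h3
  unfold GaugeConfig.negReflect
  by_cases hi : i = 0
  · subst hi
    simp only [if_true]
    rw [hUV _ ⟨-t - 1, by omega, by omega, ?_⟩]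
    simp only [WilsonSiteRP.negReflect_apply_zero, WilsonRP.shift_apply_self, h3]
    push_cast
    ring
  · simp only [hi, if_false]
    rw [hUV _ ⟨-t, by omega, by omega, ?_⟩]
    simp only [WilsonSiteRP.negReflect_apply_zero, h3, Int.cast_neg]

omit [Group G] [TopologicalSpace G] [IsTopologicalGroup G] [CompactSpace G] [MeasurableSpace G] [BorelSpace G] in
/-- **Windows inside `[1, w]` are slabs**: if `1 ≤ lo`, `hi ≤ w` and `w < Sd`, reading `[lo, hi]` implies depending only on
the slab `slabEdges Sd w` of `…UclGap`. -/
theorem ReadsTimes.dependsOn_slabEdges {Sd : ℕ} [NeZero Sd] {α : Type*} {X : GaugeConfig 4 Sd G → α} {lo hi : ℤ} {w : ℕ}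
    (h : ReadsTimes X lo hi) (hlo : 1 ≤ lo) (hhi : hi ≤ w) (hw : w < Sd) : DependsOn X (slabEdges Sd w) := by
  refine DependsOn.mono (fun e he => ?_) h
  obtain ⟨t, h1, h2, h3⟩ := he
  have ht0 : 0 ≤ t := by omega
  have htS : t < Sd := by omega
  have hval : ((t : ZMod Sd).val : ℤ) = t := by
    rw [ZMod.val_intCast, Int.emod_eq_of_lt ht0 htS]
  simp only [slabEdges, Set.mem_setOf_eq, h3]
  constructor <;> omega

/-! ## The observable of a time-windowed test function -/

/-- The curvature weight at `x` reads only the lattice times `[x⁰ − R₀, x⁰ + R₀]`, `R₀` the time radius of the curvature species. -/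
theorem readsTimes_cw (r : LatticeRep G) (sch : SpeciesScheme (YMSpecies G)) (k : ℕ) (x : Site 4) :
    ReadsTimes (cw r sch k x) (x 0 - timeRadius r.curvature) (x 0 + timeRadius r.curvature) := by
  intro U V hUV
  unfold cw
  congr 2
  refine r.curvature.isCylinder fun e he => ?_
  simp only [Literature.MathematicalPhysics.QuantumLattice.configShift_apply, torusLift, Function.comp_apply]
  refine hUV _ ⟨(e.1 - -x) 0, ?_, ?_, ?_⟩
  · have := abs_le.1 (abs_le_timeRadius r.curvature he); simp only [Pi.sub_apply, Pi.neg_apply]; omega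
  · have := abs_le.1 (abs_le_timeRadius r.curvature he); simp only [Pi.sub_apply, Pi.neg_apply]; omega
  · simp [torusEdge, Torus.proj_apply]

omit [Group G] [TopologicalSpace G] [IsTopologicalGroup G] [CompactSpace G] [MeasurableSpace G] [BorelSpace G] in
/-- Products of window-readers read the window. -/
theorem ReadsTimes.finset_prod {Sd : ℕ} {ι : Type*} (s : Finset ι) {X : ι → GaugeConfig 4 Sd G → ℂ} {lo hi : ℤ}
    (h : ∀ i ∈ s, ReadsTimes (X i) lo hi) : ReadsTimes (fun U => ∏ i ∈ s, X i U) lo hi :=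
  fun _ _ hUV => Finset.prod_congr rfl fun i hi => h i hi hUV

omit [Group G] [TopologicalSpace G] [IsTopologicalGroup G] [CompactSpace G] [MeasurableSpace G] [BorelSpace G] in
/-- Sums of window-readers read the window. -/
theorem ReadsTimes.finset_sum {Sd : ℕ} {ι : Type*} (s : Finset ι) {X : ι → GaugeConfig 4 Sd G → ℂ} {lo hi : ℤ}
    (h : ∀ i ∈ s, ReadsTimes (X i) lo hi) : ReadsTimes (fun U => ∑ i ∈ s, X i U) lo hi :=
  fun _ _ hUV => Finset.sum_congr rfl fun i hi => h i hi hUV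

/-- **Windowed test functions give window-reading observables.** If every point of the support of `F` has physical time in
`[lo, hi]`, then `obsOf r sch k p F` reads only the lattice times `[⌈lo/a_k⌉ − R₀, ⌊hi/a_k⌋ + R₀]`. -/
theorem readsTimes_obsOf (r : LatticeRep G) (sch : SpeciesScheme (YMSpecies G)) (k p : ℕ) {F : 𝓢((Fin p → 𝔼), ℂ)}
    {lo hi : ℝ} (hF : tsupport (F : (Fin p → 𝔼) → ℂ) ⊆ {x | ∀ j, lo ≤ x j 0 ∧ x j 0 ≤ hi}) :
    ReadsTimes (obsOf r sch k p F) (⌈lo / sch.a k⌉ - timeRadius r.curvature) (⌊hi / sch.a k⌋ + timeRadius r.curvature) := by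
  have ha := sch.a_pos k
  intro U V hUV
  unfold obsOf
  refine Finset.sum_congr rfl fun x _ => ?_
  by_cases hx : F (fun i => sch.a k • siteToE (↑(x i) : Site 4)) = 0
  · simp [hx]
  congr 1
  refine Finset.prod_congr rfl fun j _ => ?_
  have hxj := (hF (subset_tsupport _ (Function.mem_support.2 hx))) j
  simp only [PiLp.smul_apply, siteToE_apply, smul_eq_mul] at hxj
  have h1 : ⌈lo / sch.a k⌉ ≤ ((x j : Site 4) 0) := Int.ceil_le.2 (by rw [div_le_iff₀ ha]; linarith [hxj.1])
  have h2 : ((x j : Site 4) 0) ≤ ⌊hi / sch.a k⌋ := Int.le_floor.2 (by rw [le_div_iff₀ ha]; linarith [hxj.2])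
  have h := (readsTimes_cw r sch k (x j : Site 4)).mono (lo' := ⌈lo / sch.a k⌉ - timeRadius r.curvature)
    (hi' := ⌊hi / sch.a k⌋ + timeRadius r.curvature) (by omega) (by omega)
  exact congrArg (fun z : ℝ => (z : ℂ)) (h hUV)

/-! ## From a covariance to the OS pairing -/

section OSPairing

variable (r : LatticeRep G) (sch : SpeciesScheme (YMSpecies G)) (k : ℕ)

/-- The **left OS observable** `Y = conj ∘ A ∘ τ_c ∘ Θ'` (so that `conj (Y (Θ'U)) = A (τ_c U)`). -/
def osLeft (A : GaugeConfig 4 (sch.side k) G → ℂ) (c : ℤ) (U : GaugeConfig 4 (sch.side k) G) : ℂ :=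
  conj (A (timeShiftInt (sch.side k) c U.negReflect))

/-- The **right OS observable** `Z = B ∘ τ_c ∘ τ_{−m'}` (so that `Z (τ_{m'} U) = B (τ_c U)`). -/
def osRight (B : GaugeConfig 4 (sch.side k) G → ℂ) (c : ℤ) (m' : ℕ) (U : GaugeConfig 4 (sch.side k) G) : ℂ :=
  B (timeShiftInt (sch.side k) c (timeShiftInt (sch.side k) (-(m' : ℤ)) U))

variable {r sch k}

omit [TopologicalSpace G] [IsTopologicalGroup G] [CompactSpace G] [BorelSpace G] in
/-- `conj (Y (Θ'U)) = A (τ_c U)`. -/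
theorem conj_osLeft_negReflect (A : GaugeConfig 4 (sch.side k) G → ℂ) (c : ℤ) (U : GaugeConfig 4 (sch.side k) G) :
    conj (osLeft sch k A c U.negReflect) = A (timeShiftInt (sch.side k) c U) := by
  simp [osLeft, WilsonSiteRP.negReflect_negReflect_config]

omit [TopologicalSpace G] [IsTopologicalGroup G] [CompactSpace G] [BorelSpace G] in
/-- `Z (τ_{m'} U) = B (τ_c U)`. -/
theorem osRight_torusTimeShift (B : GaugeConfig 4 (sch.side k) G → ℂ) (c : ℤ) (m' : ℕ) (U : GaugeConfig 4 (sch.side k) G) :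
    osRight sch k B c m' (torusTimeShift (sch.side k) m' U) = B (timeShiftInt (sch.side k) c U) := by
  show B (timeShiftInt _ c (timeShiftInt _ (-(m' : ℤ)) (timeShiftInt _ (m' : ℤ) U))) = _
  rw [timeShiftInt_timeShiftInt, timeShiftInt_timeShiftInt]
  congr 2
  ring

omit [CompactSpace G] in
/-- Measurability of `Y`. -/
theorem measurable_osLeft {A : GaugeConfig 4 (sch.side k) G → ℂ} (hA : Measurable A) (c : ℤ) : Measurable (osLeft sch k A c) :=
  (Complex.continuous_conj.measurable.comp hA).comp ((timeShiftInt (sch.side k) c).measurable.comp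
    WilsonSiteRP.measurable_negReflect)

omit [TopologicalSpace G] [IsTopologicalGroup G] [CompactSpace G] [BorelSpace G] in
/-- Measurability of `Z`. -/
theorem measurable_osRight {B : GaugeConfig 4 (sch.side k) G → ℂ} (hB : Measurable B) (c : ℤ) (m' : ℕ) :
    Measurable (osRight sch k B c m') :=
  hB.comp ((timeShiftInt (sch.side k) c).measurable.comp (timeShiftInt (sch.side k) _).measurable)

omit [TopologicalSpace G] [IsTopologicalGroup G] [CompactSpace G] [BorelSpace G] in
/-- Bounds transfer to `Y`. -/
theorem norm_osLeft_le {A : GaugeConfig 4 (sch.side k) G → ℂ} {a : ℝ} (hA : ∀ U, ‖A U‖ ≤ a) (c : ℤ) (U : GaugeConfig 4 (sch.side k) G) :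
    ‖osLeft sch k A c U‖ ≤ a := by
  rw [osLeft, RCLike.norm_conj]; exact hA _

omit [TopologicalSpace G] [IsTopologicalGroup G] [CompactSpace G] [BorelSpace G] in
/-- Bounds transfer to `Z`. -/
theorem norm_osRight_le {B : GaugeConfig 4 (sch.side k) G → ℂ} {b : ℝ} (hB : ∀ U, ‖B U‖ ≤ b) (c : ℤ) (m' : ℕ)
    (U : GaugeConfig 4 (sch.side k) G) : ‖osRight sch k B c m' U‖ ≤ b :=
  hB _

omit [TopologicalSpace G] [IsTopologicalGroup G] [CompactSpace G] [BorelSpace G] in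
/-- **Slab localisation of `Y`**: if `A` reads `[α₁, α₂]` and `c = −α₂ − 2` then `Y` reads `[1, α₂ − α₁ + 3]`. -/
theorem readsTimes_osLeft {A : GaugeConfig 4 (sch.side k) G → ℂ} {α₁ α₂ : ℤ} (hA : ReadsTimes A α₁ α₂) :
    ReadsTimes (osLeft sch k A (-α₂ - 2)) 1 (α₂ - α₁ + 3) := by
  have h := (hA.comp_timeShiftInt (-α₂ - 2)).comp_negReflect
  have h' : ReadsTimes (fun U : GaugeConfig 4 (sch.side k) G => A (timeShiftInt (sch.side k) (-α₂ - 2) U.negReflect))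
      1 (α₂ - α₁ + 3) := h.mono (by omega) (by omega)
  intro U V hUV
  exact congrArg conj (h' hUV)

omit [TopologicalSpace G] [IsTopologicalGroup G] [CompactSpace G] [BorelSpace G] in
/-- **Slab localisation of `Z`**: if `B` reads `[β₁, β₂]`, `c = −α₂ − 2` and `m' = β₁ − α₂ − 3 ≥ 0` then `Z` reads `[1, β₂ − β₁ + 1]`. -/
theorem readsTimes_osRight {B : GaugeConfig 4 (sch.side k) G → ℂ} {α₂ β₁ β₂ : ℤ} (hB : ReadsTimes B β₁ β₂) {m' : ℕ}
    (hm' : (m' : ℤ) = β₁ - α₂ - 3) : ReadsTimes (osRight sch k B (-α₂ - 2) m') 1 (β₂ - β₁ + 1) := by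
  have h := (hB.comp_timeShiftInt (-α₂ - 2)).comp_timeShiftInt (-(m' : ℤ))
  exact h.mono (by omega) (by omega)

/-- **Covariance = reflected, translated connected OS pairing** (measure invariance only):
`∫AB − ∫A∫B = osCorr μ_k Θ' τ_{m'} Y Z`. -/
theorem cov_eq_osCorr :
    ∀ {G : Type} [Group G] [TopologicalSpace G] [IsTopologicalGroup G] [CompactSpace G] [MeasurableSpace G] [BorelSpace G]
      (r : LatticeRep G) (sch : SpeciesScheme (YMSpecies G)) (k : ℕ) (A B : GaugeConfig 4 (sch.side k) G → ℂ) (c : ℤ) (m' : ℕ),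
      (∫ U, A U * B U ∂(μW r sch k)) - (∫ U, A U ∂(μW r sch k)) * ∫ U, B U ∂(μW r sch k) =
        osCorr (μW r sch k) GaugeConfig.negReflect (torusTimeShift (sch.side k) m') (osLeft sch k A c)
          (osRight sch k B c m') := by
  intro G _ _ _ _ _ _ r sch k A B c m'
  unfold osCorr
  simp only [conj_osLeft_negReflect, osRight_torusTimeShift]
  rw [integral_comp_timeShiftInt r.ρ (sch.β k) (sch.side k) c (fun U => A U * B U)]
  congr 1
  have hA : ∫ U, osLeft sch k A c U ∂(μW r sch k) = conj (∫ U, A U ∂(μW r sch k)) := by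
    unfold osLeft
    rw [integral_conj, integral_comp_negReflect_eq r.ρ r.continuous (sch.β k)
      (fun U => A (timeShiftInt (sch.side k) c U)), integral_comp_timeShiftInt r.ρ (sch.β k) (sch.side k) c A]
  have hB : ∫ U, osRight sch k B c m' U ∂(μW r sch k) = ∫ U, B U ∂(μW r sch k) := by
    unfold osRight
    rw [integral_comp_timeShiftInt r.ρ (sch.β k) (sch.side k) (-(m' : ℤ))
      (fun U => B (timeShiftInt (sch.side k) c U)), integral_comp_timeShiftInt r.ρ (sch.β k) (sch.side k) c B]
  rw [hA, hB, RingHomCompTriple.comp_apply, RingHom.id_apply]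

omit [CompactSpace G] in
/-- **Slab-goodness of the OS observables** of two bounded measurable window-readers with windows `[α₁, α₂]`, `[β₁, β₂]`,
`β₁ ≥ α₂ + 3`, inside `[1, w]` after the shifts (`α₂ − α₁ + 3 ≤ w`, `β₂ − β₁ + 1 ≤ w`, `w < side`). -/
theorem slabGood_osLeft_osRight {A B : GaugeConfig 4 (sch.side k) G → ℂ} (hAm : Measurable A) (hBm : Measurable B)
    (hAb : ∃ a, ∀ U, ‖A U‖ ≤ a) (hBb : ∃ b, ∀ U, ‖B U‖ ≤ b) {α₁ α₂ β₁ β₂ : ℤ} (hA : ReadsTimes A α₁ α₂)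
    (hB : ReadsTimes B β₁ β₂) {m' w : ℕ} (hm' : (m' : ℤ) = β₁ - α₂ - 3) (hwA : α₂ - α₁ + 3 ≤ w) (hwB : β₂ - β₁ + 1 ≤ w)
    (hw : w < sch.side k) :
    SlabGood (sch.side k) w (osLeft sch k A (-α₂ - 2)) ∧ SlabGood (sch.side k) w (osRight sch k B (-α₂ - 2) m') := by
  obtain ⟨a, ha⟩ := hAb
  obtain ⟨b, hb⟩ := hBb
  exact ⟨⟨measurable_osLeft hAm _, ⟨a, norm_osLeft_le ha _⟩, (readsTimes_osLeft hA).dependsOn_slabEdges le_rfl hwA hw⟩,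
    ⟨measurable_osRight hBm _ _, ⟨b, norm_osRight_le hb _ _⟩, (readsTimes_osRight hB hm').dependsOn_slabEdges le_rfl hwB hw⟩⟩

end OSPairing

end Summit.QuantumFields.YangMills.Cruxes.ContinuumLimitOnTrajectory.TwoOrbitSynchronisation

end
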